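import Summits.CriticalPhenomena.PercolationContinuityZ3.Theorems.PercNearOneGluingNoHeavyLowerTailSahiSymCubeCanon
import Summits.CriticalPhenomena.PercolationContinuityZ3.Theorems.PercNearOneGluingNoHeavyLowerTailSahiCubeFiveAllOrders
import Literature.Combinatorics.Sahi2008.CumulationCone

/-!
# Sahi's `C_n` on the cube `{0,1}^m` by coloured antichains modulo the symmetries of the cube, III: SOUNDNESS — from a passing
# symmetry-reduced check to `SahiPositive (bernoulliWeight p) n` for every product weight

Support file (cell `prim-sahi`, seat `prim-sahi-typer` gen 29; `--supports stmt-CriticalPhenomena-4575`).  Pure proofs (one auxiliary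
definition, `coMem`); standard axioms, no `sorry`.  Parts I–II: …`SahiSymCubeCheck` (the checker `symCheck m n σb`, completeness),
…`SahiSymCubeOrbit` / …`SahiSymCubeCanon` (orbits, `exists_canonical`).

* `coMem m E c i = {S | ∀ x ∈ E, c x = i → ¬ S ⊆ pt m x}` — the member of colour `i` co-generated by a coloured point set; `encA_coMem` — its
  bitmask is the checker's `memN m (maskC …)`;
* `testN_sound` — the tree's digit test (`NCopyCert.sahiE_ind_nonneg_of_checkFamW`, every order) is a sound leaf test;
* `sahiE_coMem_imgE` — **`E_k` of a co-generated family is invariant under the coordinate permutations** (`p ↦ p ∘ σ⁻¹`; `sahiE_comp_equiv`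
  along `S ↦ σ '' S`, `bernoulliWeight_image_perm`);
* **`coMem_core_nonneg`** — THE CORE BOUND: if `symCheckT m (n+2) test` passes for a sound `test`, then `E_{n+2}(μ_p; U_0, …, U_{n+1}) ≥ 0` for
  the family co-generated by ANY antichain with ANY colouring using all colours, under EVERY product weight (transport to the canonical
  representative, relabel the colours by `sahiE_comp_perm`, read the tested leaf via `canonE_complete` + `colourPhase_complete`);
* **`sahiPositive_of_symCheckT`**, **`sahiPositive_of_symCheck`** — `SahiPositive (bernoulliWeight p) (n+2)` from the check and the orders
  `≤ n+1` for the same weight (`SahiAbsorbed.sahiPositive_of_surjColouring`); `sahiE_ind_nonneg_of_symCheck` — events form. [this work]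
-/
namespace Summit.CriticalPhenomena.PercolationContinuityZ3.Theorems.SahiSymCube

open Finset OneCutCert CovTransferCert SahiC3Cube NCopyCert
open Literature.Combinatorics.Sahi2008
open Literature.Probability.Percolation.BHK2006 (weight)
open Literature.Probability.Percolation.DecisionTree (ind ind_nonneg ind_of_mem ind_of_not_mem)

/-! ## Co-generated members of a coloured point set -/

/-- The member of colour `i` CO-GENERATED by the coloured point set `(E, c)`: the sets contained in no point of colour `i`. [this work] -/
def coMem (m : ℕ) (E : Finset ℕ) (c : ℕ → ℕ) (i : ℕ) : Set (Set (Fin m)) := {S | ∀ x ∈ E, c x = i → ¬ S ⊆ pt m x}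

/-- Co-generated members are increasing events. [this work] -/
theorem isUpperSet_coMem (m : ℕ) (E : Finset ℕ) (c : ℕ → ℕ) (i : ℕ) : IsUpperSet (coMem m E c i) :=
  fun _ _ hle hS x hx hcx hsub => hS x hx hcx (le_trans hle hsub)

/-- **The bitmask of a co-generated member is the checker's member** `memN m (maskC …)` of the colour list `(keyE E).map c`. [this work] -/
theorem encA_coMem (m : ℕ) (E : Finset ℕ) (c : ℕ → ℕ) (i : ℕ) :
    encA m (coMem m E c i) = memN m (maskC m (keyE E) ((keyE E).map c) i) := by
  classical
  refine Nat.eq_of_testBit_eq fun y => ?_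
  rw [testBit_encA, testBit_memN]
  unfold maskC
  rw [testBit_ofBits]
  by_cases hy : y < 2 ^ m
  · simp only [hy, decide_true, Bool.true_and]
    have key : pt m y ∈ coMem m E c i ↔
        ¬ ∃ j < (keyE E).length, ((keyE E).map c).getD j 0 = i ∧ y &&& (keyE E).getD j 0 = y := by
      unfold coMem
      rw [Set.mem_setOf_eq]
      constructor
      · rintro h ⟨j, hj, hc, hyx⟩
        rw [List.getD_eq_getElem _ _ (by rw [List.length_map]; exact hj), List.getElem_map] at hc
        rw [List.getD_eq_getElem _ _ hj] at hyx
        have hx : (keyE E)[j] ∈ E := mem_keyE.1 (List.getElem_mem hj)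
        exact h _ hx hc ((land_eq_self_iff_pt_subset _ hy).1 hyx)
      · intro h x hx hcx hsub
        obtain ⟨j, hj, rfl⟩ := List.getElem_of_mem (mem_keyE.2 hx)
        refine h ⟨j, hj, ?_, ?_⟩
        · rw [List.getD_eq_getElem _ _ (by rw [List.length_map]; exact hj), List.getElem_map]; exact hcx
        · rw [List.getD_eq_getElem _ _ hj]; exact (land_eq_self_iff_pt_subset _ hy).2 hsub
    by_cases hq : ∃ j < (keyE E).length, ((keyE E).map c).getD j 0 = i ∧ y &&& (keyE E).getD j 0 = y
    · rw [decide_eq_true hq, decide_eq_false (fun h => key.1 h hq)]; rfl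
    · rw [decide_eq_false hq, decide_eq_true (key.2 hq)]; rfl
  · simp [hy]

/-! ## The tree's digit test is a sound leaf test -/

/-- **`testN` is sound**: a passing test on the bitmasks of a family of events gives `E_n ≥ 0` for every product weight. [this work] -/
theorem testN_sound {m n σb : ℕ} (A : Fin n → Set (Set (Fin m))) (h : testN m n σb (fun i => encA m (A i)) = true)
    (p : Fin m → unitInterval) : 0 ≤ sahiE (bernoulliWeight p) n (fun i => ind (A i)) := by
  unfold testN at h
  simp only [Bool.and_eq_true, decide_eq_true_eq] at h
  obtain ⟨⟨hσ, hbnd⟩, h⟩ := h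
  exact sahiE_ind_nonneg_of_checkFamW hσ hbnd (fun _ => rfl) p A h

/-! ## Transport along a coordinate permutation -/

/-- The product weight transports: `μ_{p ∘ σ⁻¹}(σ(ω)) = μ_p(ω)`. [this work] -/
theorem bernoulliWeight_image_perm {m : ℕ} (σ : Equiv.Perm (Fin m)) (p : Fin m → unitInterval) (ω : Set (Fin m)) :
    bernoulliWeight (p ∘ σ.symm) (σ '' ω) = bernoulliWeight p ω := by
  simp only [bernoulliWeight, weight]
  exact (Fintype.prod_equiv σ _ _ fun i => by by_cases hi : i ∈ ω <;> simp [hi]).symm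

/-- Co-generated members transport: `σ '' S` avoids the points of `σ • E` of colour `i` (colouring pulled back along `σ⁻¹`) iff `S` avoids the
points of `E` of colour `i`. [this work] -/
theorem image_mem_coMem_imgE {m : ℕ} (σ : Equiv.Perm (Fin m)) {E : Finset ℕ} (hE : ∀ x ∈ E, x < 2 ^ m) (d : ℕ → ℕ) (i : ℕ)
    (S : Set (Fin m)) : σ '' S ∈ coMem m (imgE m σ E) (fun x => d (actP m σ⁻¹ x)) i ↔ S ∈ coMem m E d i := by
  unfold coMem
  simp only [Set.mem_setOf_eq]
  constructor
  · intro h x hx hdx hsub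
    refine h (actP m σ x) (mem_imgE.2 ⟨x, hx, rfl⟩) (by rw [actP_inv_actP σ (hE x hx)]; exact hdx) ?_
    rw [pt_actP]; exact Set.image_mono hsub
  · intro h y hy hdy hsub
    obtain ⟨x, hx, rfl⟩ := mem_imgE.1 hy
    rw [actP_inv_actP σ (hE x hx)] at hdy
    rw [pt_actP, Set.image_subset_image_iff σ.injective] at hsub
    exact h x hx hdy hsub

/-- **`E_k` of a co-generated family is invariant under the coordinate permutations** (weight `p ↦ p ∘ σ⁻¹`). [this work] -/
theorem sahiE_coMem_imgE {m : ℕ} (σ : Equiv.Perm (Fin m)) (p : Fin m → unitInterval) {E : Finset ℕ} (hE : ∀ x ∈ E, x < 2 ^ m)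
    (d : ℕ → ℕ) (k : ℕ) :
    sahiE (bernoulliWeight (p ∘ σ.symm)) k (fun j : Fin k => ind (coMem m (imgE m σ E) (fun x => d (actP m σ⁻¹ x)) (j : ℕ))) =
      sahiE (bernoulliWeight p) k (fun j : Fin k => ind (coMem m E d (j : ℕ))) := by
  have h := sahiE_comp_equiv (Equiv.Set.congr σ) (bernoulliWeight (p ∘ σ.symm)) k
    (fun j : Fin k => ind (coMem m (imgE m σ E) (fun x => d (actP m σ⁻¹ x)) (j : ℕ)))
  have hμ : (bernoulliWeight (p ∘ σ.symm) ∘ (Equiv.Set.congr σ)) = bernoulliWeight p := by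
    funext ω; exact bernoulliWeight_image_perm σ p ω
  have hf : (fun j : Fin k => ind (coMem m (imgE m σ E) (fun x => d (actP m σ⁻¹ x)) (j : ℕ)) ∘ (Equiv.Set.congr σ)) =
      fun j : Fin k => ind (coMem m E d (j : ℕ)) := by
    funext j S
    show ind _ (σ '' S) = ind _ S
    by_cases hS : S ∈ coMem m E d j
    · rw [ind_of_mem hS, ind_of_mem ((image_mem_coMem_imgE σ hE d j S).2 hS)]
    · rw [ind_of_not_mem hS, ind_of_not_mem fun h' => hS ((image_mem_coMem_imgE σ hE d j S).1 h')]
  rw [hμ, hf] at h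
  exact h.symm

/-! ## The core bound -/

/-- **THE CORE BOUND.**  If the check with a sound leaf test passes, then for every antichain `E` of points of the `m`-cube and every colouring
`d` using all `n + 2` colours on `E`, `E_{n+2}(μ_p; U_0, …, U_{n+1}) ≥ 0` for the co-generated family under EVERY product weight: transport
to the canonical representative of the orbit (`exists_canonical`, `sahiE_coMem_imgE`), relabel the colours (`sahiE_comp_perm`), and read the
test at the leaf the checker visited (`canonE_complete`, `colourPhase_complete`). [this work] -/
theorem coMem_core_nonneg {m n : ℕ} {test : (Fin (n + 2) → ℕ) → Bool}
    (htest : ∀ A : Fin (n + 2) → Set (Set (Fin m)), test (fun i => encA m (A i)) = true →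
      ∀ p : Fin m → unitInterval, 0 ≤ sahiE (bernoulliWeight p) (n + 2) (fun i => ind (A i)))
    (h : symCheckT m (n + 2) test = true) {E : Finset ℕ} (hE : ∀ x ∈ E, x < 2 ^ m)
    (hanti : ∀ x ∈ E, ∀ y ∈ E, x ≠ y → x &&& y ≠ x) {d : ℕ → ℕ} (hdn : ∀ x ∈ E, d x < n + 2)
    (hsurj : ∀ i < n + 2, ∃ x ∈ E, d x = i) (p : Fin m → unitInterval) :
    0 ≤ sahiE (bernoulliWeight p) (n + 2) (fun j : Fin (n + 2) => ind (coMem m E d (j : ℕ))) := by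
  obtain ⟨σ, hcanE, hcanC⟩ := exists_canonical m E d
  -- the canonical representative
  set E' := imgE m σ E with hE'
  set d' : ℕ → ℕ := fun x => d (actP m σ⁻¹ x) with hd'
  set P := keyE E' with hP
  set l := P.map d' with hl
  have hE'lt : ∀ y ∈ E', y < 2 ^ m := imgE_lt σ E
  have hmem : E' ∈ canonE m := canonE_complete E' hE'lt (imgE_anti σ hE hanti) hcanE
  have hphase : colourPhase m (n + 2) test E' = true := by
    unfold symCheckT at h
    exact List.all_eq_true.1 h E' hmem
  -- the values of the transported colouring
  have hd'E : ∀ y ∈ E', ∃ x ∈ E, d' y = d x := by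
    intro y hy
    obtain ⟨x, hx, rfl⟩ := mem_imgE.1 hy
    refine ⟨x, hx, ?_⟩
    show d (actP m σ⁻¹ (actP m σ x)) = d x
    rw [actP_inv_actP σ (hE x hx)]
  set fol := folAux [] l with hfol
  have hmem_fol : ∀ a, a ∈ fol ↔ ∃ y ∈ E', d' y = a := by
    intro a
    rw [hfol, mem_folAux, hl, List.mem_map]
    simp only [List.not_mem_nil, false_or]
    constructor
    · rintro ⟨y, hy, rfl⟩; exact ⟨y, mem_keyE.1 hy, rfl⟩
    · rintro ⟨y, hy, rfl⟩; exact ⟨y, mem_keyE.2 hy, rfl⟩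
  have hfol_lt : ∀ a ∈ fol, a < n + 2 := by
    intro a ha
    obtain ⟨y, hy, rfl⟩ := (hmem_fol a).1 ha
    obtain ⟨x, hx, e⟩ := hd'E y hy
    rw [e]; exact hdn x hx
  have hfol_mem : ∀ i < n + 2, i ∈ fol := by
    intro i hi
    obtain ⟨x, hx, hdx⟩ := hsurj i hi
    refine (hmem_fol i).2 ⟨actP m σ x, mem_imgE.2 ⟨x, hx, rfl⟩, ?_⟩
    show d (actP m σ⁻¹ (actP m σ x)) = i
    rw [actP_inv_actP σ (hE x hx), hdx]
  have hfol_nd : fol.Nodup := folAux_nodup l List.nodup_nil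
  have hfol_len : fol.length = n + 2 := by
    rw [← List.toFinset_card_of_nodup hfol_nd]
    have hsub : fol.toFinset = range (n + 2) := by
      ext a
      rw [List.mem_toFinset, mem_range]
      exact ⟨hfol_lt a, hfol_mem a⟩
    rw [hsub, card_range]
  -- the relabelled colour list is a tested leaf
  obtain ⟨hrg, hnc⟩ := rgOK_rgsAux (n := n + 2) l [] List.nodup_nil (le_of_eq hfol_len)
  rw [List.length_nil] at hrg hnc
  rw [hfol_len] at hnc
  have hlen : (rgs l).length = E'.card := by
    show (rgsAux [] l).length = _
    rw [length_rgsAux, hl, List.length_map, hP, length_keyE]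
  have hpass := colourPhase_complete hphase (rgs l) hlen hrg hnc hcanC
  -- the relabelling `φ` and the relabelled colouring `c₁`
  set φ : ℕ → ℕ := fun a => fol.idxOf a with hφ
  set c₁ : ℕ → ℕ := fun x => φ (d' x) with hc₁
  have hrgs : rgs l = P.map c₁ := by
    show rgsAux [] l = _
    rw [rgsAux_eq_map, hl, List.map_map]; rfl
  rw [hrgs] at hpass
  have hA : (fun i : Fin (n + 2) => memN m (maskC m P (P.map c₁) i)) = fun i : Fin (n + 2) => encA m (coMem m E' c₁ (i : ℕ)) := by
    funext i; rw [encA_coMem]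
  rw [hA] at hpass
  have hpos : ∀ p', 0 ≤ sahiE (bernoulliWeight p') (n + 2) (fun i : Fin (n + 2) => ind (coMem m E' c₁ (i : ℕ))) :=
    htest (fun i : Fin (n + 2) => coMem m E' c₁ (i : ℕ)) hpass
  -- undo the relabelling: `φ` restricted to the colours is a permutation
  have hφlt : ∀ j < n + 2, φ j < n + 2 := by
    intro j hj
    rw [← hfol_len]
    exact List.idxOf_lt_length_of_mem (hfol_mem j hj)
  have hφinj : ∀ a ∈ fol, ∀ b ∈ fol, φ a = φ b → a = b := by
    intro a ha b hb hab
    have h1 := List.getElem_idxOf (List.idxOf_lt_length_of_mem ha)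
    have h2 := List.getElem_idxOf (List.idxOf_lt_length_of_mem hb)
    rw [← h1, ← h2]
    simp only [hφ] at hab
    simp only [hab]
  let f : Fin (n + 2) → Fin (n + 2) := fun j => ⟨φ j, hφlt j j.isLt⟩
  have hfinj : Function.Injective f := by
    intro j₁ j₂ hj
    exact Fin.ext (hφinj _ (hfol_mem _ j₁.isLt) _ (hfol_mem _ j₂.isLt) (congrArg Fin.val hj))
  let π : Equiv.Perm (Fin (n + 2)) := Equiv.ofBijective f (Finite.injective_iff_bijective.1 hfinj)
  have hrel : (fun j : Fin (n + 2) => ind (coMem m E' d' (j : ℕ))) =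
      fun j : Fin (n + 2) => ind (coMem m E' c₁ ((π j : Fin (n + 2)) : ℕ)) := by
    funext j
    have hπj : ((π j : Fin (n + 2)) : ℕ) = φ j := by simp [π, f]
    rw [hπj]
    congr 1
    ext S
    simp only [coMem, Set.mem_setOf_eq, hc₁]
    constructor
    · intro hS y hy hcy
      exact hS y hy (hφinj _ ((hmem_fol _).2 ⟨y, hy, rfl⟩) _ (hfol_mem _ j.isLt) hcy)
    · intro hS y hy hcy
      exact hS y hy (by rw [hcy])
  have hperm := sahiE_comp_perm (bernoulliWeight (p ∘ σ.symm)) (n + 2) π (fun i : Fin (n + 2) => ind (coMem m E' c₁ (i : ℕ)))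
  have hpos' : 0 ≤ sahiE (bernoulliWeight (p ∘ σ.symm)) (n + 2) (fun j : Fin (n + 2) => ind (coMem m E' d' (j : ℕ))) := by
    rw [hrel, hperm]
    exact hpos _
  -- undo the coordinate permutation
  rwa [sahiE_coMem_imgE σ p hE d (n + 2)] at hpos'

/-! ## Sahi positivity of the product weight -/

open scoped Classical in
/-- The co-generated family of a coloured antichain of `Set (Fin m)` in the tree's form is the family `coMem` of its bitmasks. [this work] -/
theorem setInd_coMember_eq_ind_coMem {m n : ℕ} (N : Finset (Set (Fin m))) (c : Set (Fin m) → Fin n) :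
    (fun i : Fin n => setInd (univ.filter fun q : Set (Fin m) => ∀ T ∈ N, c T = i → ¬ q ≤ T)) =
      fun i : Fin n => ind (coMem m (N.image encS) (fun x => (c (pt m x) : ℕ)) (i : ℕ)) := by
  funext i ω
  have key : (∀ T ∈ N, c T = i → ¬ ω ≤ T) ↔ ω ∈ coMem m (N.image encS) (fun x => (c (pt m x) : ℕ)) i := by
    unfold coMem
    rw [Set.mem_setOf_eq]
    constructor
    · intro h x hx hcx
      obtain ⟨T, hT, rfl⟩ := mem_image.1 hx
      dsimp only at hcx
      rw [pt_encS] at hcx ⊢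
      exact h T hT (Fin.ext hcx)
    · intro h T hT hcT hle
      refine h (encS T) (mem_image.2 ⟨T, hT, rfl⟩) (by dsimp only; rw [pt_encS, hcT]) ?_
      rw [pt_encS]; exact hle
  rw [setInd_apply]
  by_cases hω : ∀ T ∈ N, c T = i → ¬ ω ≤ T
  · rw [if_pos (mem_filter.2 ⟨mem_univ _, hω⟩), ind_of_mem (key.1 hω)]
  · rw [if_neg (fun h => hω (mem_filter.1 h).2), ind_of_not_mem (fun h => hω (key.2 h))]

/-- **SAHI POSITIVITY OF ORDER `n + 2` OF A PRODUCT WEIGHT FROM THE SYMMETRY-REDUCED CHECK** (any sound leaf test), given the orders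
`1, …, n + 1` for the same weight (value-level saturation with surjective colourings, `SahiAbsorbed.sahiPositive_of_surjColouring`). [this work] -/
theorem sahiPositive_of_symCheckT {m n : ℕ} {test : (Fin (n + 2) → ℕ) → Bool}
    (htest : ∀ A : Fin (n + 2) → Set (Set (Fin m)), test (fun i => encA m (A i)) = true →
      ∀ p : Fin m → unitInterval, 0 ≤ sahiE (bernoulliWeight p) (n + 2) (fun i => ind (A i)))
    (h : symCheckT m (n + 2) test = true) (p : Fin m → unitInterval)
    (hlow : ∀ k, 1 ≤ k → k ≤ n + 1 → SahiPositive (bernoulliWeight p) k) : SahiPositive (bernoulliWeight p) (n + 2) := by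
  classical
  refine SahiAbsorbed.sahiPositive_of_surjColouring (isFKGMeasure_bernoulliWeight p).nonneg
    (isFKGMeasure_bernoulliWeight p).sum_eq_one hlow fun N c hN hsurj => ?_
  have hE : ∀ x ∈ N.image encS, x < 2 ^ m := by
    intro x hx
    obtain ⟨T, -, rfl⟩ := mem_image.1 hx
    exact encS_lt T
  have hanti : ∀ x ∈ N.image encS, ∀ y ∈ N.image encS, x ≠ y → x &&& y ≠ x := by
    intro x hx y hy hxy hland
    obtain ⟨T, hT, rfl⟩ := mem_image.1 hx
    obtain ⟨T', hT', rfl⟩ := mem_image.1 hy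
    have hsub : T ⊆ T' := by
      have := (land_eq_self_iff_pt_subset (encS T') (encS_lt T)).1 hland
      rwa [pt_encS, pt_encS] at this
    exact hN (mem_coe.2 hT) (mem_coe.2 hT') (fun h => hxy (by rw [h])) hsub
  have hsurj' : ∀ i < n + 2, ∃ x ∈ N.image encS, (fun x => ((c (pt m x) : Fin (n + 2)) : ℕ)) x = i := by
    intro i hi
    obtain ⟨T, hT, hcT⟩ := hsurj ⟨i, hi⟩
    exact ⟨encS T, mem_image.2 ⟨T, hT, rfl⟩, by simp only [pt_encS, hcT]⟩
  have key := coMem_core_nonneg htest h hE hanti (fun x _ => (c (pt m x)).isLt) hsurj' p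
  convert key using 2
  exact setInd_coMember_eq_ind_coMem N c

/-- **SAHI POSITIVITY OF ORDER `n + 2` FROM `symCheck m (n+2) σb = true`** (leaf test = the tree's digit test `NCopyCert.checkFamW`), given
the lower orders for the same product weight. [this work] -/
theorem sahiPositive_of_symCheck {m n σb : ℕ} (h : symCheck m (n + 2) σb = true) (p : Fin m → unitInterval)
    (hlow : ∀ k, 1 ≤ k → k ≤ n + 1 → SahiPositive (bernoulliWeight p) k) : SahiPositive (bernoulliWeight p) (n + 2) :=
  sahiPositive_of_symCheckT (fun A hA p' => testN_sound A hA p') h p hlow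

/-- Events form: `E_{n+2}(μ_p; A_0, …, A_{n+1}) ≥ 0` for increasing events of `Set (Fin m)`. [this work] -/
theorem sahiE_ind_nonneg_of_symCheck {m n σb : ℕ} (h : symCheck m (n + 2) σb = true) (p : Fin m → unitInterval)
    (hlow : ∀ k, 1 ≤ k → k ≤ n + 1 → SahiPositive (bernoulliWeight p) k) {A : Fin (n + 2) → Set (Set (Fin m))}
    (hA : ∀ i, IsUpperSet (A i)) : 0 ≤ sahiE (bernoulliWeight p) (n + 2) (fun i => ind (A i)) :=
  sahiPositive_of_symCheck h p hlow _ (fun _ _ => ind_nonneg _ _) (fun i => monotone_ind_of_isUpperSet (hA i))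

end Summit.CriticalPhenomena.PercolationContinuityZ3.Theorems.SahiSymCube
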